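import Literature.ModelTheory.ExponentialFields.PilaWilkieLastVariablePrep
import Literature.ModelTheory.ExponentialFields.PilaWilkieLimitCharts
import Literature.ModelTheory.ExponentialFields.PilaWilkieMonotoneCharts
import Literature.ModelTheory.ExponentialFields.PilaWilkieKeyEstimate
import Literature.ModelTheory.ExponentialFields.PilaWilkieCellParametrization
import HarnessLib

/-!
# The change of the last variable (Bhardwaj–van den Dries 2022, Lemma 6.2), uniformly in parameters, vector-valued

Topic `Literature/ModelTheory/ExponentialFields`; proof file in the cone of the named fact
`PilaWilkie2006_thm_1_8`.  Bhardwaj–van den Dries 2022, Lemma 6.2 is the analytic heart of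
the o-minimal reparametrization theorem (hence of the Pila–Wilkie counting theorem): for a
definable open `U ⋐ (0,1)^{m+1}` and a definable `C¹` function `f` on `U` with `f` and
`∂f/∂x_i` (`i ≤ m`) strongly bounded, there are a `(k−1)`-parametrization `Φ` of a cofinite
subset of `(0,1)` and `V ⋐ U` with `I_φ(V) ⊆ U`, `f_φ = f ∘ I_φ` of class `C¹` on `V` and all
`∂f_φ/∂x_i` (`i ≤ m+1`) strongly bounded, where `I_φ(x) = (x', φ(x_{m+1}))`.

`lastVariable_step` proves this over `ℝ`, **uniformly in parameters** `v ∈ ℝ^p` (all data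
definable families, finitely many chart families, explicit bound `max B₁ (3 + m B₁)`) and for a
**tuple** `f_c` of functions at once (the auxiliary point `a_s(t)` maximizes
`max_c |∂f_c/∂x_{m+1}(·, t)|` over `U_s(t)`; this makes Cor. 6.3 of the paper unnecessary).
The proof follows the printed one: `U_s(t)` and the definable selector `a_s(t)`
(`PilaWilkieLastVariablePrep`), the reparametrization `Φ_s` of `g_s = (a_s, f ∘ (a_s, id))` by
the unary theorem (`uniform_r_parametrization`), the limit charts and Lemma 6.1
(`limitCharts`), strictly monotone normalization (`normalized_charts`), `V = U ∩ ⋂ I_φ⁻¹(U)`,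
`V ⋐ U` by `interior_preimage_changeLast_eq_empty`, and the estimate (i)–(v)
(`key_estimate`).

* `sub_le_one_of_Ioo_subset`, `update_last_eq_snoc_init`, `exists_definableFun_max` — small
  tools;
* **`lastVariable_step`** — the statement above.

Nothing here is a named fact; no definitions.

## References

* N. Bhardwaj, L. van den Dries, *On the Pila–Wilkie theorem*, Expo. Math. 40 (2022), §6,
  Lemma 6.2. [BhardwajVanDenDries2022]
* J. Pila, A. J. Wilkie, *The rational points of a definable set*, Duke Math. J. 133 (2006),
  §4, Lemma 4.2. [PilaWilkie2006]
-/

noncomputable section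

open Set FirstOrder FirstOrder.Language Filter Topology Function

namespace Literature.ModelTheory.ExponentialFields

/-! ### Bhardwaj–van den Dries 2022, Lemma 6.2, uniformly in parameters, vector-valued -/

section LastVariable

open Classical

variable {L : FirstOrder.Language.{0, 0}} [L.Structure ℝ]

/-- Local notation: the open unit cube `(0,1)^ℓ`. -/
local notation "𝕀^" ℓ:max => (Set.pi Set.univ fun _ : Fin ℓ => Set.Ioo (0 : ℝ) 1)

/-- A gap `(α, β) ⊆ (0, 1)` with `α < β` has length `≤ 1`. [folklore] -/
theorem sub_le_one_of_Ioo_subset {α β : ℝ} (hlt : α < β) (hsub : Ioo α β ⊆ Ioo (0 : ℝ) 1) :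
    0 ≤ α ∧ β ≤ 1 := by
  constructor
  · by_contra h; push Not at h
    have hm : (α + min β 0) / 2 ∈ Ioo α β := by
      have : min β 0 ≤ 0 := min_le_right _ _
      have : α < min β 0 := lt_min hlt h
      constructor <;> linarith [min_le_left β 0]
    have := (hsub hm).1
    have : min β 0 ≤ 0 := min_le_right _ _
    have : α < min β 0 := lt_min hlt h
    linarith
  · by_contra h; push Not at h
    have hm : (max α 1 + β) / 2 ∈ Ioo α β := by
      have : 1 ≤ max α 1 := le_max_right _ _
      have : max α 1 < β := max_lt hlt h
      constructor <;> linarith [le_max_left α 1]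
    have := (hsub hm).2
    have : 1 ≤ max α 1 := le_max_right _ _
    have : max α 1 < β := max_lt hlt h
    linarith

/-- `update x last y = snoc (init x) y`. [folklore] -/
theorem update_last_eq_snoc_init {m : ℕ} (x : Fin (m + 1) → ℝ) (y : ℝ) :
    Function.update x (Fin.last m) y = Fin.snoc (Fin.init x) y := by
  ext i
  refine Fin.lastCases ?_ (fun j => ?_) i
  · simp
  · rw [Function.update_of_ne (Fin.castSucc_lt_last j).ne, Fin.snoc_castSucc]; rfl

/-- **The definable maximum of finitely many definable functions.** [folklore] -/
theorem exists_definableFun_max {α : Type} [Finite α] {n : ℕ}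
    (hadd : (univ : Set ℝ).Definable L {v : Fin 3 → ℝ | v 0 + v 1 = v 2})
    (hmul : (univ : Set ℝ).Definable L {v : Fin 3 → ℝ | v 0 * v 1 = v 2})
    (D : Fin n → (α → ℝ) → ℝ) (hD : ∀ c, (univ : Set ℝ).DefinableFun L (D c)) :
    ∃ M : (α → ℝ) → ℝ, (univ : Set ℝ).DefinableFun L M ∧ (∀ c u, |D c u| ≤ M u) ∧
      (∀ u, 0 < n → ∃ c, M u = |D c u|) ∧ (n = 0 → ∀ u, M u = 0) := by
  have hlt := definable_lt_of_field hadd hmul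
  induction n with
  | zero => exact ⟨fun _ => 0, definableFun_const' _ _, fun c => c.elim0, fun u h => absurd h (lt_irrefl 0), fun _ _ => rfl⟩
  | succ n ih =>
    obtain ⟨M, hMdef, hMle, hMeq, hM0⟩ := ih (fun c => D (Fin.castSucc c)) (fun c => hD _)
    have habs : (univ : Set ℝ).DefinableFun L (fun u => |D (Fin.last n) u|) := by
      have h : (fun u => |D (Fin.last n) u|) = fun u => if D (Fin.last n) u < 0 then -D (Fin.last n) u else D (Fin.last n) u := by
        funext u; split_ifs with h
        · exact abs_of_neg h
        · exact abs_of_nonneg (not_lt.mp h)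
      rw [h]
      exact Set.DefinableFun.ite (definable_setOf_lt hlt (hD _) (definableFun_const' _ _))
        (definableFun_neg hadd (hD _)) (hD _)
    refine ⟨fun u => if M u ≤ |D (Fin.last n) u| then |D (Fin.last n) u| else M u, ?_, ?_, ?_, fun h => absurd h (Nat.succ_ne_zero n)⟩
    · exact Set.DefinableFun.ite (definable_setOf_le hlt hMdef habs) habs hMdef
    · intro c u
      refine Fin.lastCases ?_ (fun c' => ?_) c
      · simp only; split_ifs with h
        · exact le_rfl
        · push Not at h; exact h.le
      · have := hMle c' u
        simp only at this ⊢; split_ifs with h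
        · exact this.trans h
        · exact this
    · intro u _
      simp only
      split_ifs with h
      · exact ⟨Fin.last n, rfl⟩
      · rcases Nat.eq_zero_or_pos n with hn | hn
        · subst hn
          exact absurd (by rw [hM0 rfl u]; exact abs_nonneg _) h
        · obtain ⟨c, hc⟩ := hMeq u hn
          exact ⟨Fin.castSucc c, hc⟩

/-- **Bhardwaj–van den Dries 2022, Lemma 6.2, uniformly in parameters over `ℝ`, for a tuple
of functions** (*"Let `U ⋐ 𝕀^{m+1}` be definable and open, and suppose `∂f/∂x_i` is strongly
bounded on `U` for `i = 1,…,m`. Then there is a `(k−1)`-parametrization `Φ` of a cofinite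
subset of `𝕀` and a set `V ⋐ U` such that for every `φ ∈ Φ`: `I_φ(V) ⊆ U`, `f_φ` is of class
`C¹` on `V`, and `∂f_φ/∂x_i` is strongly bounded on `V` for `i = 1,…,m+1`"*): the families
over `v ∈ ℝ^p` of open definable `U_v ⊆ (0,1)^{m+1}` with `int((0,1)^{m+1} ∖ U_v) = ∅` and
of definable `f_c(v,·)`, `C¹` on `U_v` with `|f_c| ≤ 1`, `|∂f_c/∂x_i| ≤ B₁` (`i ≤ m`); the
charts `φ` are finitely many definable families of strictly monotone `C^{k−1}` maps
`(0,1) → (0,1)` with `|φ^{(i)}| ≤ 1` covering `(0,1)` up to finitely many points, `V` is a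
definable family, and on `V_v`: `I_φ(V_v) ⊆ U_v`, `f_c ∘ I_φ` is `C¹` and all its first
partials are bounded by `max B₁ (3 + m B₁)`.  Proof as printed (vector-valued: the point
`a_s(t)` maximizes `max_c |∂f_c/∂x_{m+1}(·, t)|` on `U_s(t)`), with o-minimal limits in place
of `ℵ₀`-saturation. [cite: BhardwajVanDenDries2022, Lemma 6.2] -/
theorem lastVariable_step {p m n k : ℕ} (hO : L.IsOMinimal ℝ)
    (hadd : (univ : Set ℝ).Definable L {v : Fin 3 → ℝ | v 0 + v 1 = v 2})
    (hmul : (univ : Set ℝ).Definable L {v : Fin 3 → ℝ | v 0 * v 1 = v 2})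
    (hk : 2 ≤ k)
    (U : Set (Fin (p + (m + 1)) → ℝ)) (hU : (univ : Set ℝ).Definable L U)
    (hUopen : ∀ v : Fin p → ℝ, IsOpen {x : Fin (m + 1) → ℝ | (Fin.append v x :) ∈ U})
    (hUcube : ∀ v : Fin p → ℝ, {x : Fin (m + 1) → ℝ | (Fin.append v x :) ∈ U} ⊆ 𝕀^(m + 1))
    (hUbig : ∀ v : Fin p → ℝ, interior (𝕀^(m + 1) \ {x : Fin (m + 1) → ℝ | (Fin.append v x :) ∈ U}) = ∅)
    (f : Fin n → (Fin (p + (m + 1)) → ℝ) → ℝ) (hf : ∀ c, (univ : Set ℝ).DefinableFun L (f c))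
    (hfC1 : ∀ c v, ContDiffOn ℝ 1 (fun x => f c (Fin.append v x)) {x | (Fin.append v x :) ∈ U})
    (hfbd : ∀ c v, ∀ x : Fin (m + 1) → ℝ, (Fin.append v x :) ∈ U → |f c (Fin.append v x)| ≤ 1)
    {B₁ : ℝ}
    (hfB : ∀ c v, ∀ x : Fin (m + 1) → ℝ, (Fin.append v x :) ∈ U →
      ∀ i : Fin m, |pderiv (Fin.castSucc i) (fun x => f c (Fin.append v x)) x| ≤ B₁) :
    ∃ (K : Type) (_ : Fintype K) (φ : K → (Fin p → ℝ) → ℝ → ℝ) (V : Set (Fin (p + (m + 1)) → ℝ)),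
      (∀ j, IsDefinableFamily₁ L (φ j)) ∧ (univ : Set ℝ).Definable L V ∧
      ∀ v : Fin p → ℝ,
        (∀ j, StrictMonoOn (φ j v) (Ioo 0 1) ∨ StrictAntiOn (φ j v) (Ioo 0 1)) ∧
        (∀ j, MapsTo (φ j v) (Ioo 0 1) (Ioo 0 1)) ∧
        (∀ j, ContDiffOn ℝ ((k - 1 : ℕ) : WithTop ℕ∞) (φ j v) (Ioo 0 1)) ∧
        (∀ j, ∀ i ≤ k - 1, ∀ t ∈ Ioo (0 : ℝ) 1, |iteratedDerivWithin i (φ j v) (Ioo 0 1) t| ≤ 1) ∧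
        (Ioo (0 : ℝ) 1 \ ⋃ j, φ j v '' Ioo 0 1).Finite ∧
        {x : Fin (m + 1) → ℝ | (Fin.append v x :) ∈ V} ⊆ {x | (Fin.append v x :) ∈ U} ∧
        IsOpen {x : Fin (m + 1) → ℝ | (Fin.append v x :) ∈ V} ∧
        interior ({x : Fin (m + 1) → ℝ | (Fin.append v x :) ∈ U} \ {x | (Fin.append v x :) ∈ V}) = ∅ ∧
        ∀ j, MapsTo (fun x : Fin (m + 1) → ℝ => Function.update x (Fin.last m) (φ j v (x (Fin.last m))))
              {x | (Fin.append v x :) ∈ V} {x | (Fin.append v x :) ∈ U} ∧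
          (∀ c, ContDiffOn ℝ 1
            (fun x => f c (Fin.append v (Function.update x (Fin.last m) (φ j v (x (Fin.last m))))))
            {x | (Fin.append v x :) ∈ V}) ∧
          (∀ c, ∀ x : Fin (m + 1) → ℝ, (Fin.append v x :) ∈ V → ∀ i : Fin (m + 1),
            |pderiv i (fun x => f c (Fin.append v (Function.update x (Fin.last m) (φ j v (x (Fin.last m)))))) x|
              ≤ max B₁ (3 + m * B₁)) := by
  have hlt := definable_lt_of_field hadd hmul
  have hk1 : 1 ≤ k - 1 := by omega
  ----------------------------------------------------------------- S0: `f` extended by `0`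
  set fe : Fin n → (Fin (p + (m + 1)) → ℝ) → ℝ := fun c u => if u ∈ U then f c u else 0 with hfe
  have hfedef : ∀ c, (univ : Set ℝ).DefinableFun L (fe c) := fun c =>
    Set.DefinableFun.ite hU (hf c) (definableFun_const' _ _)
  have hfebd : ∀ c u, |fe c u| ≤ 1 := by
    intro c u; simp only [hfe]; split_ifs with h
    · -- `u = append v x`
      have hu : (Fin.append (fun i => u (Fin.castAdd (m + 1) i)) (fun j => u (Fin.natAdd p j)) :) = u := by
        ext l; refine Fin.addCases (fun i => ?_) (fun j => ?_) l <;> simp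
      have := hfbd c (fun i => u (Fin.castAdd (m + 1) i)) (fun j => u (Fin.natAdd p j)) (by rw [hu]; exact h)
      rwa [hu] at this
    · simp
  -- the fibre functions `g c v`
  set g : Fin n → (Fin p → ℝ) → (Fin (m + 1) → ℝ) → ℝ := fun c v x => fe c (Fin.append v x) with hg
  have hgf : ∀ c v, EqOn (g c v) (fun x => f c (Fin.append v x)) {x | (Fin.append v x :) ∈ U} := by
    intro c v x hx; simp only [hg, hfe, mem_setOf_eq.mp hx, if_true]
  have hgC1 : ∀ c v, ContDiffOn ℝ 1 (g c v) {x | (Fin.append v x :) ∈ U} := fun c v =>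
    (hfC1 c v).congr (hgf c v)
  have hgpd : ∀ c v, ∀ x : Fin (m + 1) → ℝ, (Fin.append v x :) ∈ U → ∀ i,
      pderiv i (g c v) x = pderiv i (fun x => f c (Fin.append v x)) x := fun c v x hx i =>
    pderiv_congr_of_eqOn (hUopen v) (hgf c v) i hx
  ----------------------------------------------------------------- S1: canonical last partials
  obtain ⟨L', inst', ψb, hψb, hdef', -⟩ := exists_orderedRing_expansion (L := L) hadd hmul
  have hDf : ∀ c, ∃ D : (Fin (p + (m + 1)) → ℝ) → ℝ, (univ : Set ℝ).DefinableFun L D ∧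
      ∀ u d, HasPartialDerivAt (fe c) (Fin.natAdd p (Fin.last m)) d u → D u = d := by
    intro c
    have hfe' : (univ : Set ℝ).DefinableFun L' (fe c) := by
      unfold Set.DefinableFun; exact (hdef' _).mpr (hfedef c)
    obtain ⟨D, hD, hspec⟩ := exists_definableFun_partial ψb hfe' (Fin.natAdd p (Fin.last m))
    exact ⟨D, by unfold Set.DefinableFun at hD ⊢; exact (hdef' _).mp hD, hspec⟩
  choose Df hDfdef hDfspec using hDf
  -- on `U_v`, `Df c (v, x) = ∂g_c/∂x_{m+1}(x)`
  have hDfeq : ∀ c v, ∀ x : Fin (m + 1) → ℝ, (Fin.append v x :) ∈ U →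
      Df c (Fin.append v x) = pderiv (Fin.last m) (g c v) x := by
    intro c v x hx
    apply hDfspec
    rw [← hasPartialDerivAt_append_iff]
    have hdiff : DifferentiableAt ℝ (g c v) x :=
      ((hgC1 c v).differentiableOn one_ne_zero x hx).differentiableAt ((hUopen v).mem_nhds hx)
    rw [hasPartialDerivAt_iff, hasFieldDerivAt_iff_hasDerivAt]
    exact hasDerivAt_section_of_differentiableAt hdiff (Fin.last m)
  ----------------------------------------------------------------- S2: the maximum `M`
  obtain ⟨M, hMdef, hMle, hMeq, -⟩ := exists_definableFun_max hadd hmul Df hDfdef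
  ----------------------------------------------------------------- S3: the selector `a_s(t)`
  -- parameters `w = ((v, s), t) : (Fin (p+1) ⊕ Unit) → ℝ`; the ball set `Kset` and `M` read at `(v, (a, t))`
  set Kset : Set ((Fin (p + 1) ⊕ Unit) ⊕ Fin m → ℝ) := {e |
      ∀ y : Fin (m + 1) → ℝ,
        (∀ i : Fin (m + 1), y i - (Fin.snoc (fun j => e (Sum.inr j)) (e (Sum.inl (Sum.inr ()))) : Fin (m + 1) → ℝ) i <
            e (Sum.inl (Sum.inl (Fin.last p))) ∧
          (Fin.snoc (fun j => e (Sum.inr j)) (e (Sum.inl (Sum.inr ()))) : Fin (m + 1) → ℝ) i - y i <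
            e (Sum.inl (Sum.inl (Fin.last p)))) →
        (Fin.append (fun j : Fin p => e (Sum.inl (Sum.inl (Fin.castSucc j)))) y :) ∈ U} with hKset
  have hKsetdef : (univ : Set ℝ).Definable L Kset := definable_ballSet hadd hmul hU
  -- the total point `(v, (a, t))` as a function of `e`
  set tot : ((Fin (p + 1) ⊕ Unit) ⊕ Fin m → ℝ) → Fin (p + (m + 1)) → ℝ := fun e =>
    Fin.append (fun j : Fin p => e (Sum.inl (Sum.inl (Fin.castSucc j))))
      (Fin.snoc (fun j => e (Sum.inr j)) (e (Sum.inl (Sum.inr ())))) with htot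
  have htotdef : (univ : Set ℝ).DefinableMap L tot := by
    intro l
    refine Fin.addCases (fun i => ?_) (fun j => ?_) l
    · simp only [htot, Fin.append_left]; exact definableFun_proj _
    · simp only [htot, Fin.append_right]
      refine Fin.lastCases ?_ (fun j' => ?_) j
      · simp only [Fin.snoc_last]; exact definableFun_proj _
      · simp only [Fin.snoc_castSucc]; exact definableFun_proj _
  obtain ⟨sel, hseldef, hsel⟩ := exists_definable_argmax hadd hmul Kset hKsetdef (fun e => M (tot e)) (hMdef.comp htotdef)
  -- clamped coordinates of the selector, as unary families in `t` with parameters `w' = (v, s)`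
  set A : Fin m → (Fin (p + 1) → ℝ) → ℝ → ℝ := fun i w' t =>
    max (-1) (min 1 (sel (Sum.elim w' (fun _ => t)) i)) with hA
  have hAdef : ∀ i, IsDefinableFamily₁ L (A i) := by
    intro i γ _ qm tm hqm htm
    refine definableFun_clamp hlt ((hseldef i).comp (fun l => ?_))
    cases l with
    | inl l => exact hqm l
    | inr _ => exact htm
  have hAbd : ∀ i w' t, |A i w' t| ≤ 1 := fun i w' t => abs_clamp_le _
  -- the values `fe c (v, A(w', t), t)`
  set Fv : Fin n → (Fin (p + 1) → ℝ) → ℝ → ℝ := fun c w' t =>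
    fe c (Fin.append (Fin.init w') (Fin.snoc (fun i => A i w' t) t)) with hFv
  have hFvdef : ∀ c, IsDefinableFamily₁ L (Fv c) := by
    intro c γ _ qm tm hqm htm
    refine (hfedef c).comp (fun l => ?_)
    refine Fin.addCases (fun i => ?_) (fun j => ?_) l
    · simp only [Fin.append_left]; exact hqm _
    · simp only [Fin.append_right]
      refine Fin.lastCases ?_ (fun j' => ?_) j
      · simp only [Fin.snoc_last]; exact htm
      · simp only [Fin.snoc_castSucc]; exact (hAdef j').definableFun hqm htm
  ----------------------------------------------------------------- S4/S5: the reparametrization `Φ`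
  set Fur : Fin (m + n + 1) → (Fin (p + 1) → ℝ) → ℝ → ℝ :=
    Fin.cases (fun _ t => t) (Fin.addCases A Fv) with hFur
  have hFurdef : ∀ l, IsDefinableFamily₁ L (Fur l) := by
    intro l
    refine Fin.cases ?_ (fun l' => ?_) l
    · simp only [hFur, Fin.cases_zero]; exact IsDefinableFamily₁.id
    · simp only [hFur, Fin.cases_succ]
      refine Fin.addCases (fun i => ?_) (fun c => ?_) l'
      · simp only [Fin.addCases_left]; exact hAdef i
      · simp only [Fin.addCases_right]; exact hFvdef c
  have hFur0 : ∀ w' t, Fur 0 w' t = t := fun w' t => by simp [hFur]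
  have hFurbd : ∀ l w', ∀ t ∈ Ioo (0 : ℝ) 1, |Fur l w' t| ≤ 1 := by
    intro l w' t ht
    refine Fin.cases ?_ (fun l' => ?_) l
    · simp only [hFur, Fin.cases_zero]; rw [abs_le]; exact ⟨by linarith [ht.1], ht.2.le⟩
    · simp only [hFur, Fin.cases_succ]
      refine Fin.addCases (fun i => ?_) (fun c => ?_) l'
      · simp only [Fin.addCases_left]; exact hAbd i w' t
      · simp only [Fin.addCases_right]; exact hfebd c _
  obtain ⟨ι, hι, Φ, hΦdef, hΦ⟩ := uniform_r_parametrization hO hadd hmul Fur hFurdef hFur0 hFurbd k (by omega)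
  -- unpacked consequences for the charts themselves (`l = 0`)
  have hΦCk : ∀ i w', ContDiffOn ℝ k (Φ i w') (Ioo 0 1) := by
    intro i w'
    have h := (hΦ w').2.1 i 0
    simpa only [hFur0] using h
  have hΦbd : ∀ i w', ∀ q ≤ k, ∀ t ∈ Ioo (0 : ℝ) 1, |iteratedDerivWithin q (Φ i w') (Ioo 0 1) t| ≤ 1 := by
    intro i w' q hq t ht
    have h := (hΦ w').2.2.1 i 0 q hq t ht
    simpa only [hFur0] using h
  have hΦmaps : ∀ i w', MapsTo (Φ i w') (Ioo 0 1) (Ioo 0 1) := fun i w' => (hΦ w').1 i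
  have hΦcov : ∀ w', Ioo (0 : ℝ) 1 ⊆ ⋃ i, Φ i w' '' Ioo 0 1 := fun w' => (hΦ w').2.2.2.symm.subset
  ----------------------------------------------------------------- S6: the limit charts `G`
  obtain ⟨G, hGdef, hG⟩ := limitCharts hO hadd hmul hk Φ hΦdef hΦCk hΦbd hΦmaps hΦcov
  ----------------------------------------------------------------- S7: normalized charts `φ`
  obtain ⟨K, hKfin, φ, hφdef, hφ⟩ := normalized_charts hO hadd hmul hk1 G hGdef
    (fun j v => (hG v).1 j) (fun j v => (hG v).2.1 j) (fun j v => (hG v).2.2.1 j) (fun v => (hG v).2.2.2.2)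
  ----------------------------------------------------------------- S8: the set `V`
  -- the total change of variable `u ↦ (v, I_{φ_j(v,·)}(x))`
  set Tchg : K → (Fin (p + (m + 1)) → ℝ) → Fin (p + (m + 1)) → ℝ := fun j u =>
    Fin.append (fun i : Fin p => u (Fin.castAdd (m + 1) i))
      (Function.update (fun l : Fin (m + 1) => u (Fin.natAdd p l)) (Fin.last m)
        (φ j (fun i : Fin p => u (Fin.castAdd (m + 1) i)) (u (Fin.natAdd p (Fin.last m))))) with hTchg
  have hTchgdef : ∀ j, (univ : Set ℝ).DefinableMap L (Tchg j) := by
    intro j l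
    refine Fin.addCases (fun i => ?_) (fun l' => ?_) l
    · simp only [hTchg, Fin.append_left]; exact definableFun_proj _
    · simp only [hTchg, Fin.append_right]
      by_cases hl' : l' = Fin.last m
      · subst hl'
        simp only [Function.update_self]
        exact (hφdef j).definableFun (fun i => definableFun_proj _) (definableFun_proj _)
      · simp only [Function.update_of_ne hl']; exact definableFun_proj _
  set V : Set (Fin (p + (m + 1)) → ℝ) := U ∩ ⋂ j, (Tchg j) ⁻¹' U with hV
  have hVdef : (univ : Set ℝ).Definable L V := hU.inter (definable_iInter_of_finite fun j => hU.preimage_map (hTchgdef j))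
  -- the fibre change of variable
  set chg : K → (Fin p → ℝ) → (Fin (m + 1) → ℝ) → Fin (m + 1) → ℝ := fun j v x =>
    Function.update x (Fin.last m) (φ j v (x (Fin.last m))) with hchg
  have hTchg_append : ∀ j v (x : Fin (m + 1) → ℝ), Tchg j (Fin.append v x) = Fin.append v (chg j v x) := by
    intro j v x
    simp only [hTchg, hchg, Fin.append_left, Fin.append_right]
  have hVfib : ∀ v (x : Fin (m + 1) → ℝ), (Fin.append v x :) ∈ V ↔
      (Fin.append v x :) ∈ U ∧ ∀ j, (Fin.append v (chg j v x) :) ∈ U := by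
    intro v x
    simp only [hV, mem_inter_iff, mem_iInter, mem_preimage, hTchg_append]
  refine ⟨K, hKfin, φ, V, hφdef, hVdef, fun v => ?_⟩
  obtain ⟨hsrc, hmono, hmapsφ, hCkφ, hbdφ, hcofφ⟩ := hφ v
  set Uv : Set (Fin (m + 1) → ℝ) := {x | (Fin.append v x :) ∈ U} with hUv
  set Vv : Set (Fin (m + 1) → ℝ) := {x | (Fin.append v x :) ∈ V} with hVv
  have hVv : Vv = Uv ∩ ⋂ j, {x | chg j v x ∈ Uv} := by
    ext x; simp only [hVv, hUv, mem_setOf_eq, mem_inter_iff, mem_iInter, hVfib]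
  have hVU : Vv ⊆ Uv := fun x hx => by rw [hVv] at hx; exact hx.1
  have hchgU : ∀ j, MapsTo (chg j v) Vv Uv := fun j x hx => by
    rw [hVv] at hx; exact mem_iInter.mp hx.2 j
  -- continuity / smoothness of the change of variable on `{x | x_{m+1} ∈ (0,1)}`
  have hφdiff : ∀ j, ∀ t ∈ Ioo (0 : ℝ) 1, DifferentiableAt ℝ (φ j v) t := fun j t ht =>
    ((hCkφ j).differentiableOn (by exact_mod_cast Nat.one_le_iff_ne_zero.mp hk1) t ht).differentiableAt
      (isOpen_Ioo.mem_nhds ht)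
  have hchgC1 : ∀ j, ContDiffOn ℝ 1 (chg j v) {x : Fin (m + 1) → ℝ | x (Fin.last m) ∈ Ioo (0 : ℝ) 1} := by
    intro j
    rw [contDiffOn_pi]
    intro l
    by_cases hl : l = Fin.last m
    · subst hl
      simp only [hchg, Function.update_self]
      have h1 : ContDiffOn ℝ 1 (φ j v) (Ioo 0 1) := (hCkφ j).of_le (by exact_mod_cast hk1)
      exact h1.comp (contDiffOn_pi.mp contDiffOn_id (Fin.last m)) fun x hx => hx
    · simp only [hchg, Function.update_of_ne hl]
      exact contDiffOn_pi.mp contDiffOn_id l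
  have hchgcont : ∀ j, ContinuousOn (chg j v) {x : Fin (m + 1) → ℝ | x (Fin.last m) ∈ Ioo (0 : ℝ) 1} :=
    fun j => (hchgC1 j).continuousOn
  have hslab : IsOpen {x : Fin (m + 1) → ℝ | x (Fin.last m) ∈ Ioo (0 : ℝ) 1} :=
    isOpen_Ioo.preimage (continuous_apply _)
  have hUslab : Uv ⊆ {x : Fin (m + 1) → ℝ | x (Fin.last m) ∈ Ioo (0 : ℝ) 1} := fun x hx =>
    hUcube v hx (Fin.last m) (mem_univ _)
  have hVopen : IsOpen Vv := by
    rw [hVv]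
    · -- `Uv ∩ ⋂ (slab ∩ chg⁻¹ Uv) = Uv ∩ ⋂ chg⁻¹ Uv`
      have heq : Uv ∩ ⋂ j, {x | chg j v x ∈ Uv} =
          Uv ∩ ⋂ j, ({x : Fin (m + 1) → ℝ | x (Fin.last m) ∈ Ioo (0 : ℝ) 1} ∩ (chg j v) ⁻¹' Uv) := by
        ext x
        simp only [mem_inter_iff, mem_iInter, mem_setOf_eq, mem_preimage]
        constructor
        · rintro ⟨h1, h2⟩; exact ⟨h1, fun j => ⟨hUslab h1, h2 j⟩⟩
        · rintro ⟨h1, h2⟩; exact ⟨h1, fun j => (h2 j).2⟩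
      rw [heq]
      exact (hUopen v).inter (isOpen_iInter_of_finite fun j => (hchgcont j).isOpen_inter_preimage hslab (hUopen v))
  ----------------------------------------------------------------- `V_v` is large in `U_v`
  have hVbig : interior (Uv \ Vv) = ∅ := by
    have hdiff : Uv \ Vv = ⋃ j ∈ (Finset.univ : Finset K), (Uv ∩ {x | chg j v x ∉ Uv}) := by
      ext x
      simp only [hVv, Set.mem_sdiff, mem_inter_iff, mem_iInter, mem_iUnion, Finset.mem_univ, true_and, mem_setOf_eq,
        not_and, not_forall, exists_prop]
      constructor
      · rintro ⟨h1, h2⟩; obtain ⟨j, hj⟩ := h2 h1; exact ⟨j, h1, hj⟩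
      · rintro ⟨j, h1, hj⟩; exact ⟨h1, fun _ => ⟨j, hj⟩⟩
    rw [hdiff]
    apply interior_biUnion_eq_empty_of_definable (Nat.succ_pos m) hO hlt
    · intro j _
      refine (definable_fibre_append hU v).inter ?_
      have h := (hU.preimage_map (hTchgdef j)).compl
      have h' := definable_fibre_append h v
      convert h' using 1
      ext x
      simp only [mem_setOf_eq, mem_compl_iff, mem_preimage, hTchg_append, hUv]
    · intro j _
      -- `⊆ {x | x_{m+1} ∈ (0,1) ∧ chg x ∈ 𝕀 ∖ Uv}`, of empty interior
      have hsub : Uv ∩ {x | chg j v x ∉ Uv} ⊆ {x : Fin (m + 1) → ℝ | x (Fin.last m) ∈ Ioo (0 : ℝ) 1 ∧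
          Function.update x (Fin.last m) (φ j v (x (Fin.last m))) ∈ 𝕀^(m + 1) \ Uv} := by
        rintro x ⟨hxU, hxn⟩
        refine ⟨hUslab hxU, ?_, hxn⟩
        intro l _
        by_cases hl : l = Fin.last m
        · subst hl; simp only [Function.update_self]; exact hmapsφ j (hUslab hxU)
        · rw [Function.update_of_ne hl]; exact hUcube v hxU l (mem_univ _)
      have h := interior_preimage_changeLast_eq_empty (m := m) ((hCkφ j).continuousOn) (hmono j) (hUbig v)
      exact subset_empty_iff.mp ((interior_mono hsub).trans h.subset)
  refine ⟨hmono, hmapsφ, hCkφ, hbdφ, hcofφ, hVU, hVopen, hVbig, fun j => ⟨hchgU j, fun c => ?_, fun c x hx i => ?_⟩⟩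
  · ------------------------------------------------------------- `f_c ∘ I_φ` is `C¹` on `V_v`
    have h1 : ContDiffOn ℝ 1 (fun x => g c v (chg j v x)) Vv :=
      (hgC1 c v).comp ((hchgC1 j).mono fun x hx => hUslab (hVU hx)) (hchgU j)
    refine h1.congr fun x hx => ?_
    exact (hgf c v (hchgU j hx)).symm
  · ------------------------------------------------------------- the bounds
    rcases Nat.eq_zero_or_pos n with hn0 | hnpos
    · subst hn0; exact c.elim0
    have hxV : x ∈ Vv := hx
    have hxU : x ∈ Uv := hVU hxV
    have hcU : chg j v x ∈ Uv := hchgU j hxV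
    have ht₀ : x (Fin.last m) ∈ Ioo (0 : ℝ) 1 := hUslab hxU
    -- replace `f` by `g` (they agree on `U_v ⊇ I_φ(V_v)`)
    have hEq : EqOn (fun y => f c (Fin.append v (Function.update y (Fin.last m) (φ j v (y (Fin.last m))))))
        (fun y => g c v (chg j v y)) Vv := fun y hy => (hgf c v (hchgU j hy)).symm
    rw [pderiv_congr_of_eqOn hVopen hEq i hxV]
    have hgd : DifferentiableAt ℝ (g c v) (chg j v x) :=
      ((hgC1 c v).differentiableOn one_ne_zero _ hcU).differentiableAt ((hUopen v).mem_nhds hcU)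
    have hφd : DifferentiableAt ℝ (φ j v) (x (Fin.last m)) := hφdiff j _ ht₀
    have hgd' : DifferentiableAt ℝ (g c v) (Function.update x (Fin.last m) (φ j v (x (Fin.last m)))) := hgd
    refine Fin.lastCases ?_ (fun i' => ?_) i
    · ----------------------------------------------------------- the last partial
      rw [show (fun y => g c v (chg j v y)) = fun y => g c v (Function.update y (Fin.last m) (φ j v (y (Fin.last m)))) from rfl,
        pderiv_comp_changeLast_last hgd' hφd]
      obtain ⟨jι, α, β, hαβ, hsub, -, hφeq⟩ := hsrc j
      set t₁ : ℝ := α + (β - α) * x (Fin.last m) with ht₁def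
      have ht₁ : t₁ ∈ Ioo α β := mapsTo_affine_Ioo hαβ ht₀
      have ht₁I : t₁ ∈ Ioo (0 : ℝ) 1 := hsub ht₁
      obtain ⟨hα0, hβ1⟩ := sub_le_one_of_Ioo_subset hαβ hsub
      have hGd : DifferentiableAt ℝ (G jι v) t₁ :=
        (((hG v).1 jι).differentiableOn (by exact_mod_cast Nat.one_le_iff_ne_zero.mp hk1) t₁ ht₁I).differentiableAt
          (isOpen_Ioo.mem_nhds ht₁I)
      have hderφ : deriv (φ j v) (x (Fin.last m)) = (β - α) * deriv (G jι v) t₁ := by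
        have hφfun : φ j v = (G jι v) ∘ fun t => α + (β - α) * t := funext hφeq
        have haff : HasDerivAt (fun t : ℝ => α + (β - α) * t) (β - α) (x (Fin.last m)) := by
          simpa using ((hasDerivAt_id (x (Fin.last m))).const_mul (β - α)).const_add α
        have hcomp : HasDerivAt ((G jι v) ∘ fun t => α + (β - α) * t) (deriv (G jι v) t₁ * (β - α)) (x (Fin.last m)) :=
          HasDerivAt.comp (x (Fin.last m)) (h₂ := G jι v) (h := fun t => α + (β - α) * t) hGd.hasDerivAt haff
        rw [hφfun, hcomp.deriv]
        ring
      have hchgx : chg j v x = Fin.snoc (Fin.init x) (G jι v t₁) := by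
        simp only [hchg]; rw [update_last_eq_snoc_init, hφeq]
      rw [hderφ, mul_assoc, abs_mul]
      have hchgx' : Function.update x (Fin.last m) (φ j v (x (Fin.last m))) = Fin.snoc (Fin.init x) (G jι v t₁) := hchgx
      rw [hchgx']
      -- the hypotheses of the key estimate
      have hconv := (hG v).2.2.2.1 jι
      have hlim0 : Tendsto (fun s => Φ jι (Fin.snoc v s) t₁) (𝓝[>] 0) (𝓝 (G jι v t₁)) := by
        have h := hconv 0 (by omega) t₁ ht₁I
        simpa only [iteratedDerivWithin_zero] using h
      have hderiv_eq : ∀ (h : ℝ → ℝ), iteratedDerivWithin 1 h (Ioo 0 1) t₁ = deriv h t₁ := fun h => by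
        rw [iteratedDerivWithin_one, derivWithin_of_isOpen isOpen_Ioo ht₁I]
      have hlim1 : Tendsto (fun s => deriv (Φ jι (Fin.snoc v s)) t₁) (𝓝[>] 0) (𝓝 (deriv (G jι v) t₁)) := by
        have h := hconv 1 (by omega) t₁ ht₁I
        simpa only [hderiv_eq] using h
      have hF1 : ∀ s ∈ Ioo (0 : ℝ) 1, |deriv (Φ jι (Fin.snoc v s)) t₁| ≤ 1 := fun s _ => by
        rw [← hderiv_eq]; exact hΦbd jι _ 1 (by omega) t₁ ht₁I
      have ha₀U : (Fin.snoc (Fin.init x) (G jι v t₁) : Fin (m + 1) → ℝ) ∈ Uv := by rw [← hchgx]; exact hcU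
      have hkey := key_estimate (hUopen v) (fun c => g c v) (fun c => hgC1 c v) (B₁ := B₁)
        (fun c y hy i => by rw [hgpd c v y hy]; exact hfB c v y hy i)
        (fun s => Φ jι (Fin.snoc v s)) (G jι v) hlim0 hlim1 hF1 ha₀U ?_ c
      · calc |β - α| * |deriv (G jι v) t₁ * pderiv (Fin.last m) (g c v) (Fin.snoc (Fin.init x) (G jι v t₁))|
            ≤ 1 * (3 + m * B₁) :=
              mul_le_mul (by rw [abs_of_pos (by linarith)]; linarith) hkey (abs_nonneg _) zero_le_one
          _ = 3 + m * B₁ := one_mul _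
          _ ≤ max B₁ (3 + m * B₁) := le_max_right _ _
      ----------------------------------------------------------- `hmax`: the maximizing point and the curves
      intro s hs hball
      set a₀ : Fin m → ℝ := Fin.init x with ha₀
      set Fs : ℝ → ℝ := Φ jι (Fin.snoc v s) with hFs
      set t : ℝ := Fs t₁ with htdef
      have htI : t ∈ Ioo (0 : ℝ) 1 := hΦmaps jι _ ht₁I
      set w : (Fin (p + 1) ⊕ Unit) → ℝ := Sum.elim (Fin.snoc v s) (fun _ => t) with hw
      -- the fibre `K_w = U_s(t)`
      have hKw : {a : Fin m → ℝ | Sum.elim w a ∈ Kset} = {a | ∀ y : Fin (m + 1) → ℝ,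
          (∀ i, y i - (Fin.snoc a t : Fin (m + 1) → ℝ) i < s ∧ (Fin.snoc a t : Fin (m + 1) → ℝ) i - y i < s) →
            (Fin.append v y :) ∈ U} := by
        ext a
        simp only [hKset, hw, mem_setOf_eq, Sum.elim_inr, Sum.elim_inl, Fin.snoc_last, Fin.snoc_castSucc]
      have htot_w : ∀ a : Fin m → ℝ, tot (Sum.elim w a) = Fin.append v (Fin.snoc a t) := by
        intro a
        simp only [htot, hw, Sum.elim_inl, Sum.elim_inr, Fin.snoc_castSucc]
      have ha₀K : a₀ ∈ {a : Fin m → ℝ | Sum.elim w a ∈ Kset} := by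
        rw [hKw]
        intro y hy
        exact hball y fun i => by rw [abs_sub_lt_iff]; exact hy i
      have hKcomp : IsCompact {a : Fin m → ℝ | Sum.elim w a ∈ Kset} := by
        rw [hKw]; exact isCompact_ballSet_fibre v (hUcube v) hs.1 t
      -- members of `K_w` lie over `U_v`
      have hKU : ∀ a ∈ {a : Fin m → ℝ | Sum.elim w a ∈ Kset}, (Fin.snoc a t : Fin (m + 1) → ℝ) ∈ Uv := by
        intro a ha
        rw [hKw] at ha
        exact ha (Fin.snoc a t) fun i => by constructor <;> linarith [hs.1]
      -- `M (v, (a, t)) = max_c |∂_{m+1} g_c (a, t)|` on `U_v`, continuous there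
      have hne : (Finset.univ : Finset (Fin n)).Nonempty := ⟨⟨0, hnpos⟩, Finset.mem_univ _⟩
      have hMU : ∀ y ∈ Uv, M (Fin.append v y) = Finset.univ.sup' hne (fun c => |pderiv (Fin.last m) (g c v) y|) := by
        intro y hy
        apply le_antisymm
        · obtain ⟨c₀, hc₀⟩ := hMeq (Fin.append v y) hnpos
          rw [hc₀, hDfeq c₀ v y hy]
          exact Finset.le_sup' (fun c => |pderiv (Fin.last m) (g c v) y|) (Finset.mem_univ c₀)
        · refine Finset.sup'_le _ _ fun c _ => ?_
          rw [← hDfeq c v y hy]; exact hMle c _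
      have hMcont : ContinuousOn (fun y => M (Fin.append v y)) Uv := by
        have hc : ContinuousOn (fun y => Finset.univ.sup' hne (fun c => |pderiv (Fin.last m) (g c v) y|)) Uv := by
          refine ContinuousOn.finset_sup'_apply hne fun c _ => ?_
          have h := ((hgC1 c v).continuousOn_fderiv_of_isOpen (hUopen v) le_rfl)
          exact (h.clm_apply continuousOn_const).abs
        exact hc.congr fun y hy => hMU y hy
      have hcontK : ContinuousOn (fun a => M (tot (Sum.elim w a))) {a : Fin m → ℝ | Sum.elim w a ∈ Kset} := by
        have h1 : ContinuousOn (fun a : Fin m → ℝ => (Fin.snoc a t : Fin (m + 1) → ℝ)) univ := by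
          refine continuousOn_pi.mpr fun l => ?_
          refine Fin.lastCases ?_ (fun j' => ?_) l
          · simp only [Fin.snoc_last]; exact continuousOn_const
          · simp only [Fin.snoc_castSucc]; exact (continuous_apply j').continuousOn
        have h2 := hMcont.comp (h1.mono (subset_univ _)) fun a ha => hKU a ha
        refine h2.congr fun a _ => ?_
        simp only [Function.comp, htot_w]
      obtain ⟨hselK, hselmax⟩ := hsel w hKcomp ⟨a₀, ha₀K⟩ hcontK
      set astar : Fin m → ℝ := sel w with hastar
      set b : Fin (m + 1) → ℝ := Fin.snoc astar t with hb
      have hbU : b ∈ Uv := hKU astar hselK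
      have hastarI : ∀ i, astar i ∈ Ioo (0 : ℝ) 1 := fun i => by
        have := hUcube v hbU (Fin.castSucc i) (mem_univ _)
        simpa only [hb, Fin.snoc_castSucc] using this
      have hAeq : ∀ i, A i (Fin.snoc v s) t = astar i := by
        intro i
        simp only [hA]
        exact clamp_eq_self (by rw [abs_le]; exact ⟨by linarith [(hastarI i).1], (hastarI i).2.le⟩)
      refine ⟨b, hbU, ⟨?_, ?_⟩⟩
      · --------------------------------------------------------- domination
        obtain ⟨c₀, hc₀⟩ := hMeq (Fin.append v b) hnpos
        refine ⟨c₀, fun c' => ?_⟩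
        have ha₀U' : (Fin.snoc a₀ t : Fin (m + 1) → ℝ) ∈ Uv := hKU a₀ ha₀K
        calc |pderiv (Fin.last m) (g c' v) (Fin.snoc a₀ t)| = |Df c' (Fin.append v (Fin.snoc a₀ t))| := by
              rw [hDfeq c' v _ ha₀U']
          _ ≤ M (Fin.append v (Fin.snoc a₀ t)) := hMle c' _
          _ = M (tot (Sum.elim w a₀)) := by rw [htot_w]
          _ ≤ M (tot (Sum.elim w astar)) := hselmax a₀ ha₀K
          _ = M (Fin.append v b) := by rw [htot_w]
          _ = |Df c₀ (Fin.append v b)| := hc₀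
          _ = |pderiv (Fin.last m) (g c₀ v) b| := by rw [hDfeq c₀ v _ hbU]
      · --------------------------------------------------------- the curves `γ`
        set γ : ℝ → Fin (m + 1) → ℝ := fun t' => Fin.snoc (fun i => A i (Fin.snoc v s) (Fs t')) (Fs t') with hγ
        have hURk := (hΦ (Fin.snoc v s)).2.1 jι
        have hURbd := (hΦ (Fin.snoc v s)).2.2.1 jι
        -- the compositions appearing in `UR`
        have hFurA : ∀ i, (fun t' => Fur (Fin.succ (Fin.castAdd n i)) (Fin.snoc v s) (Φ jι (Fin.snoc v s) t')) =
            fun t' => γ t' (Fin.castSucc i) := by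
          intro i; funext t'; simp [hFur, hγ, hFs]
        have hFurL : (fun t' => Fur 0 (Fin.snoc v s) (Φ jι (Fin.snoc v s) t')) = fun t' => γ t' (Fin.last m) := by
          funext t'; simp [hFur, hγ, hFs]
        have hFurF : ∀ c', (fun t' => Fur (Fin.succ (Fin.natAdd m c')) (Fin.snoc v s) (Φ jι (Fin.snoc v s) t')) =
            fun t' => g c' v (γ t') := by
          intro c'; funext t'; simp [hFur, hFv, hγ, hg, hFs, Fin.init_snoc]
        have hdiffAt : ∀ (h : ℝ → ℝ), ContDiffOn ℝ k h (Ioo 0 1) → DifferentiableAt ℝ h t₁ := fun h hh =>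
          (hh.differentiableOn (by exact_mod_cast show (k : ℕ) ≠ 0 by omega) t₁ ht₁I).differentiableAt
            (isOpen_Ioo.mem_nhds ht₁I)
        have hbd1 : ∀ (h : ℝ → ℝ), (∀ q ≤ k, ∀ t ∈ Ioo (0 : ℝ) 1, |iteratedDerivWithin q h (Ioo 0 1) t| ≤ 1) →
            |deriv h t₁| ≤ 1 := fun h hh => by rw [← hderiv_eq]; exact hh 1 (by omega) t₁ ht₁I
        refine ⟨γ, ?_, Filter.Eventually.of_forall fun t' => by simp [hγ], fun l => ?_, fun l => ?_, fun c' => ?_, fun c' => ?_⟩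
        · -- `γ t₁ = b`
          simp only [hγ, hb]
          congr 1
          funext i; rw [← hAeq i]
        · refine Fin.lastCases ?_ (fun i => ?_) l
          · rw [← hFurL]; exact hdiffAt _ (hURk 0)
          · rw [← hFurA i]; exact hdiffAt _ (hURk _)
        · refine Fin.lastCases ?_ (fun i => ?_) l
          · rw [← hFurL]; exact hbd1 _ (hURbd 0)
          · rw [← hFurA i]; exact hbd1 _ (hURbd _)
        · rw [← hFurF c']; exact hdiffAt _ (hURk _)
        · rw [← hFurF c']; exact hbd1 _ (hURbd _)
    · ----------------------------------------------------------- the first `m` partials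
      rw [show (fun y => g c v (chg j v y)) = fun y => g c v (Function.update y (Fin.last m) (φ j v (y (Fin.last m)))) from rfl,
        pderiv_comp_changeLast_of_ne hgd' hφd (Fin.castSucc_lt_last i').ne]
      calc |pderiv (Fin.castSucc i') (g c v) (Function.update x (Fin.last m) (φ j v (x (Fin.last m))))|
          ≤ B₁ := by rw [hgpd c v _ hcU]; exact hfB c v _ hcU i'
        _ ≤ max B₁ (3 + m * B₁) := le_max_left _ _

end LastVariable


end Literature.ModelTheory.ExponentialFields

end
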